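import Literature.AlgebraicGeometry.Resolution.HypersurfaceRestriction
import Literature.AlgebraicGeometry.Resolution.StrictTransformBaseChange
import Literature.AlgebraicGeometry.Resolution.BlowupsProperProofs
import Literature.AlgebraicGeometry.Resolution.KollarPushforward
import HarnessLib

/-!
# `SigmaMaxModificationsCorridor3` (stmt-19249), line `tame_wild` v3, helper T3 (embedded tower),
# part 1: the ideal of the strict transform of a closed subscheme under a blow-up

[OURS · L1 W4.2] General blow-up plumbing for lead res-L1-w42-lead-1's brick T3 (`hT3` of the
kernel assembly `TameWild.confinedNu3_of_bricks`, p480768) of the confined transfer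
`stub_confinedTameNu3_of_thor4` (crux `SigmaMaxModificationsCorridor3` stmt-19249, parent
`SigmaMaxModifications` stmt-18506); NOT a statement of any manuscript under review.

For a blow-up `π : X' → X` (universal property, `IsBlowup`) of a locally Noetherian scheme along
`C`, a closed immersion `i : Y ↪ X` and the strict transform ideal
`Q = ⋃ₙ (π^*𝓘_Y : 𝓘(D)ⁿ)` (`strictTransformIdeal π C i.ker`) we PROVE, for ARBITRARY (singular)
`Y` — the tree's `blowup.ker_pushforwardMap` / `IsBlowup.isBlowup_subscheme_controlledTransform`
(`HypersurfaceRestriction.lean`, `HypersurfacePushforward.lean`) treat the regular hypersurface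
case, where the union stops at `n = 1`:

* `isEffectiveCartier_comap_subschemeι_strictTransformIdeal` — the exceptional divisor restricts
  to an effective Cartier divisor on `V(Q)` (its equation is a nonzerodivisor modulo the
  saturated ideal, `mem_ideal_strictTransformIdeal_of_mul_mem`);
* `isBlowup_subscheme_strictTransformIdeal` — **`V(Q) → Y` is the blow-up of `Y` along `C|_Y`**
  (Görtz–Wedhorn I, Prop. 13.91 (1) with 13.96 (2); Stacks 080E): universality through that of
  `π`, the lift landing in `V(Q)` because `g^*𝓘(D)ⁿ · g^*(π^*𝓘_Y : 𝓘(D)ⁿ) ⊆ f^*(𝓘_Y|_Y) = 0`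
  with `g^*𝓘(D)` Cartier (`eq_bot_of_pow_mul_eq_bot_of_isEffectiveCartier`);
* `ker_eq_strictTransformIdeal_of_comp_eq` — **the ideal of the image of any morphism
  `j : Bl_{C|_Y} Y → X'` over `i` is `Q`** (`j` = the isomorphism of blow-ups followed by
  `V(Q) ↪ X'`); in particular `blowup.ker_pushforwardMap_eq_strictTransformIdeal` for Kollár's
  natural inclusion `j₁ : Bl_Z S ↪ Bl_{j_* Z} X` (3.30.2–3.30.3) of the chosen blow-ups.

## Sources
* U. Görtz, T. Wedhorn, *Algebraic Geometry I*, 2nd ed. (2020), (13.19) p. 414, Prop. 13.91,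
  Prop. 13.96 (2) p. 416. [GortzWedhorn2020]
* The Stacks Project, Tag 080E. [StacksProject]
* J. Kollár, *Lectures on Resolution of Singularities* (2007), 3.30.2–3.30.3. [Kollar2007]
-/

set_option linter.dupNamespace false -- mandated namespace of this single-conjunct summit

noncomputable section

open CategoryTheory CategoryTheory.Limits AlgebraicGeometry TopologicalSpace
open Literature.AlgebraicGeometry.Resolution

namespace Summit.ResolutionOfSingularities.ResolutionOfSingularities.Theorems.SigmaMaxModificationsCorridor3.Helpers

universe u

/-! ## Powers of an effective Cartier divisor are nonzerodivisors on ideal sheaves -/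

/-- If `P` is an effective Cartier divisor and `Pⁿ · K = 0` then `K = 0`. [folklore] -/
theorem eq_bot_of_pow_mul_eq_bot_of_isEffectiveCartier {X : Scheme.{u}} {P K : X.IdealSheafData}
    (hP : IsEffectiveCartier P) : ∀ (n : ℕ), P ^ n * K = ⊥ → K = ⊥
  | 0, h => by rwa [pow_zero, Scheme.IdealSheafData.one_eq_top, Scheme.IdealSheafData.top_mul] at h
  | n + 1, h => by
    rw [pow_succ', mul_assoc] at h
    exact eq_bot_of_pow_mul_eq_bot_of_isEffectiveCartier hP n (hP.eq_bot_of_mul_eq_bot h)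

/-! ## Sections of the strict transform ideal are saturated -/

section Sections

variable {X X' : Scheme.{u}} [IsLocallyNoetherian X'] (π : X' ⟶ X) (C H : X.IdealSheafData)

/-- On an affine open `V` where the exceptional ideal is `(g₀)`, the sections of the strict
transform ideal `Q = ⋃ₙ (π^*H : 𝓘(D)ⁿ)` are `g₀`-saturated: `s g₀ ∈ Q(V) ⇒ s ∈ Q(V)`.
[cite: GortzWedhorn2020, (13.19) p. 414] -/
theorem mem_ideal_strictTransformIdeal_of_mul_mem (V : X'.affineOpens) {g₀ : Γ(X', V)}
    (hDV : (C.comap π).ideal V = Ideal.span {g₀}) {s : Γ(X', V)}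
    (hs : s * g₀ ∈ (strictTransformIdeal π C H).ideal V) :
    s ∈ (strictTransformIdeal π C H).ideal V := by
  have hQ : (strictTransformIdeal π C H).ideal V =
      ⨆ n : ℕ, ((H.comap π).ideal V).colon ((Ideal.span {g₀ ^ n} : Ideal Γ(X', V)) : Set Γ(X', V)) := by
    rw [strictTransformIdeal, Scheme.IdealSheafData.ideal_iSup, iSup_apply]
    refine iSup_congr fun n => ?_
    rw [ideal_colon, Scheme.IdealSheafData.ideal_pow, Pi.pow_apply, hDV, Ideal.span_singleton_pow]
  have hdir : Directed (· ≤ ·) fun n : ℕ =>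
      ((H.comap π).ideal V).colon ((Ideal.span {g₀ ^ n} : Ideal Γ(X', V)) : Set Γ(X', V)) := by
    refine Monotone.directed_le fun m n hmn => ?_
    exact Submodule.colon_mono le_rfl
      (Ideal.span_singleton_le_span_singleton.mpr (pow_dvd_pow g₀ hmn))
  rw [hQ] at hs ⊢
  obtain ⟨n, hn⟩ := (Submodule.mem_iSup_of_directed _ hdir).mp hs
  refine (Submodule.mem_iSup_of_directed _ hdir).mpr ⟨n + 1, ?_⟩
  rw [Submodule.mem_colon] at hn ⊢
  intro x hx
  obtain ⟨c, rfl⟩ := Ideal.mem_span_singleton'.mp hx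
  have h1 := hn (g₀ ^ n) (Ideal.mem_span_singleton_self _)
  rw [smul_eq_mul] at h1 ⊢
  have : s * (c * g₀ ^ (n + 1)) = c * (s * g₀ * g₀ ^ n) := by ring
  rw [this]
  exact Ideal.mul_mem_left _ _ h1

end Sections

/-! ## The exceptional divisor restricts to an effective Cartier divisor on the strict transform -/

section Blowup

variable {X X' : Scheme.{u}} [IsLocallyNoetherian X] {π : X' ⟶ X} {C : X.IdealSheafData}

/-- **The exceptional divisor restricts to an effective Cartier divisor on the strict transform
`V(⋃ₙ (π^*H : 𝓘(D)ⁿ))`** of any closed subscheme `V(H)` (its equation `g₀` is a nonzerodivisor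
modulo the saturated ideal). [cite: GortzWedhorn2020, (13.19) p. 414, Prop. 13.96 (2)] -/
theorem isEffectiveCartier_comap_subschemeι_strictTransformIdeal (hπ : IsBlowup π C)
    (H : X.IdealSheafData) :
    IsEffectiveCartier ((C.comap π).comap (strictTransformIdeal π C H).subschemeι) := by
  haveI : IsProper π := hπ.isProper
  haveI : IsLocallyNoetherian X' := LocallyOfFiniteType.isLocallyNoetherian π
  set Q := strictTransformIdeal π C H with hQdef
  intro s
  obtain ⟨V, hxV, g₀, -, hDV⟩ := hπ.isEffectiveCartier (Q.subschemeι s)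
  let U' : Q.subscheme.affineOpens := ⟨Q.subschemeι ⁻¹ᵁ (V : X'.Opens), V.2.preimage _⟩
  have hsU' : s ∈ (U' : Q.subscheme.Opens) := hxV
  refine ⟨U', hsU', Q.subschemeι.app V g₀, ?_, ?_⟩
  · rw [mem_nonZeroDivisors_iff_right]
    intro y hy
    obtain ⟨s₁, rfl⟩ := Q.subschemeι_app_surjective V y
    have hmem : s₁ * g₀ ∈ RingHom.ker (Q.subschemeι.app V).hom := by
      rw [RingHom.mem_ker, map_mul]
      exact hy
    rw [Scheme.IdealSheafData.ker_subschemeι_app] at hmem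
    have hs₁ := mem_ideal_strictTransformIdeal_of_mul_mem π C H V hDV hmem
    rw [← hQdef, ← Scheme.IdealSheafData.ker_subschemeι_app Q V] at hs₁
    exact hs₁
  · rw [ideal_comap_of_le Q.subschemeι (C.comap π) V U' le_rfl, hDV, Ideal.map_span,
      Set.image_singleton, ← Scheme.Hom.app_eq_appLE]

omit [IsLocallyNoetherian X] in
/-- **The morphism from the strict transform of a closed subscheme to the subscheme**: for a
closed immersion `i : Y ↪ X`, the composite `V(⋃ₙ (π^*𝓘_Y : 𝓘(D)ⁿ)) ↪ X' → X` factors through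
`i` (`π^*𝓘_Y ⊆ ⋃ₙ (π^*𝓘_Y : 𝓘(D)ⁿ)`). [cite: GortzWedhorn2020, Prop. 13.91 (1)] -/
theorem exists_hom_subscheme_strictTransformIdeal (π : X' ⟶ X) (C : X.IdealSheafData)
    {Y : Scheme.{u}} (i : Y ⟶ X) [IsClosedImmersion i] :
    ∃ ρ : (strictTransformIdeal π C i.ker).subscheme ⟶ Y,
      ρ ≫ i = (strictTransformIdeal π C i.ker).subschemeι ≫ π := by
  have hker : i.ker ≤ ((strictTransformIdeal π C i.ker).subschemeι ≫ π).ker := by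
    rw [le_ker_iff_comap_eq_bot, Scheme.IdealSheafData.comap_comp]
    refine le_bot_iff.mp ?_
    calc (i.ker.comap π).comap (strictTransformIdeal π C i.ker).subschemeι
        ≤ (strictTransformIdeal π C i.ker).comap (strictTransformIdeal π C i.ker).subschemeι :=
          Scheme.IdealSheafData.comap_mono (f := (strictTransformIdeal π C i.ker).subschemeι)
            (comap_le_strictTransformIdeal π C i.ker)
      _ = ⊥ := comap_subschemeι_self _
  exact ⟨IsClosedImmersion.lift _ _ hker, IsClosedImmersion.lift_fac _ _ hker⟩

/-- **The strict transform of a closed subscheme is its blow-up** (Görtz–Wedhorn I, Prop. 13.91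
(1) / 13.96 (2); Stacks 080E; Kollár 3.30.2 "`B_{Z∩S} S` is naturally identified with the
birational transform"), scheme-theoretically in the tree's vocabulary: for a blow-up `π : X' → X`
of a locally Noetherian `X` along `C`, a closed immersion `i : Y ↪ X`, and the strict transform
`V(Q)`, `Q = ⋃ₙ (π^*𝓘_Y : 𝓘(D)ⁿ)`, every morphism `ρ : V(Q) → Y` over `π` is a blow-up of `Y`
along `C|_Y`: the exceptional divisor restricts to an effective Cartier divisor on `V(Q)`, and a
morphism `f : W → Y` pulling `C|_Y` back to a Cartier divisor lifts to `g : W → X'`, which lands in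
`V(Q)` because `g^*𝓘(D)ⁿ · g^*(π^*𝓘_Y : 𝓘(D)ⁿ) ⊆ g^*π^*𝓘_Y = f^*(𝓘_Y|_Y) = 0` with `g^*𝓘(D)`
Cartier. [cite: GortzWedhorn2020, Prop. 13.96 (2), p. 416] [cite: StacksProject, Tag 080E] -/
theorem isBlowup_subscheme_strictTransformIdeal (hπ : IsBlowup π C) {Y : Scheme.{u}}
    (i : Y ⟶ X) [IsClosedImmersion i]
    (ρ : (strictTransformIdeal π C i.ker).subscheme ⟶ Y)
    (hρ : ρ ≫ i = (strictTransformIdeal π C i.ker).subschemeι ≫ π) :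
    IsBlowup ρ (C.comap i) := by
  haveI : IsProper π := hπ.isProper
  haveI : IsLocallyNoetherian X' := LocallyOfFiniteType.isLocallyNoetherian π
  constructor
  · rw [← Scheme.IdealSheafData.comap_comp, hρ, Scheme.IdealSheafData.comap_comp]
    exact isEffectiveCartier_comap_subschemeι_strictTransformIdeal hπ i.ker
  · intro W f hf
    have hf' : IsEffectiveCartier (C.comap (f ≫ i)) := by
      rwa [Scheme.IdealSheafData.comap_comp]
    obtain ⟨g, hg, hgu⟩ := hπ.universal (f ≫ i) hf'
    have hDg : IsEffectiveCartier ((C.comap π).comap g) := by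
      rwa [← Scheme.IdealSheafData.comap_comp, hg]
    -- `g` lands in `V(Q)`
    have hHg : (i.ker.comap π).comap g = ⊥ := by
      rw [← Scheme.IdealSheafData.comap_comp, hg, Scheme.IdealSheafData.comap_comp, comap_ker_self,
        comap_bot]
    have hQg : (strictTransformIdeal π C i.ker).comap g = ⊥ := by
      rw [strictTransformIdeal, (Scheme.IdealSheafData.map_gc g).l_iSup]
      refine le_bot_iff.mp (iSup_le fun n => le_of_eq ?_)
      apply eq_bot_of_pow_mul_eq_bot_of_isEffectiveCartier hDg n
      refine le_bot_iff.mp ?_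
      rw [← comap_pow, ← comap_mul, ← hHg]
      exact Scheme.IdealSheafData.comap_mono (f := g) (mul_colon_le _ _)
    have hle : (strictTransformIdeal π C i.ker).subschemeι.ker ≤ g.ker := by
      rw [Scheme.IdealSheafData.ker_subschemeι, le_ker_iff_comap_eq_bot]
      exact hQg
    refine ⟨IsClosedImmersion.lift (strictTransformIdeal π C i.ker).subschemeι g hle, ?_, ?_⟩
    · show IsClosedImmersion.lift (strictTransformIdeal π C i.ker).subschemeι g hle ≫ ρ = f
      rw [← cancel_mono i, Category.assoc, hρ, IsClosedImmersion.lift_fac_assoc, hg]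
    · intro g' hg'
      have hg'' : g' ≫ ρ = f := hg'
      rw [← cancel_mono (strictTransformIdeal π C i.ker).subschemeι, IsClosedImmersion.lift_fac]
      apply hgu
      show (g' ≫ (strictTransformIdeal π C i.ker).subschemeι) ≫ π = f ≫ i
      rw [Category.assoc, ← hρ, ← Category.assoc, hg'']

/-- **The ideal of the strict transform: the kernel of the embedding `Bl_{C∩Y} Y ↪ Bl_C X` is
`⋃ₙ (π^*𝓘_Y : 𝓘(D)ⁿ)`.** For a blow-up `π : X' → X` along `C` (`X` locally Noetherian), a closed
immersion `i : Y ↪ X`, a blow-up `ρ : Y' → Y` along `C|_Y`, and any morphism `j : Y' → X'` over `i`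
(there is exactly one; it is a closed immersion, GW 13.96 (2)), `ker j` is the strict transform
ideal: `j` differs from `V(Q) ↪ X'` by the isomorphism of blow-ups `Y' ≅ V(Q)` over `Y`.
[cite: GortzWedhorn2020, Prop. 13.96 (2), p. 416] [cite: Kollar2007, 3.30.2] -/
theorem ker_eq_strictTransformIdeal_of_comp_eq (hπ : IsBlowup π C) {Y Y' : Scheme.{u}}
    (i : Y ⟶ X) [IsClosedImmersion i] {ρ : Y' ⟶ Y} (hρ : IsBlowup ρ (C.comap i)) {j : Y' ⟶ X'}
    (hj : j ≫ π = ρ ≫ i) : j.ker = strictTransformIdeal π C i.ker := by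
  obtain ⟨ρQ, hρQ⟩ := exists_hom_subscheme_strictTransformIdeal π C i
  have hQ : IsBlowup ρQ (C.comap i) := isBlowup_subscheme_strictTransformIdeal hπ i ρQ hρQ
  obtain ⟨e, he, -⟩ := hρ.unique hQ
  -- `j = e.hom ≫ ι_Q` by the universal property of `π`
  have hj' : j = e.hom ≫ (strictTransformIdeal π C i.ker).subschemeι := by
    apply hπ.hom_ext
    · rw [hj, Scheme.IdealSheafData.comap_comp]
      exact hρ.isEffectiveCartier
    · rw [hj, Category.assoc, ← hρQ, ← Category.assoc, he]
  rw [hj', Scheme.Hom.ker_comp_of_isIso, Scheme.IdealSheafData.ker_subschemeι]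

end Blowup

/-- **The ideal of Kollár's natural inclusion `j₁ : Bl_{Z} S ↪ Bl_{j_* Z} X`** (3.30.2–3.30.3) for
an ARBITRARY closed immersion `τ : S ↪ X` into a locally Noetherian `X`: `ker j₁` is the strict
transform ideal `⋃ₙ (π^*𝓘_S : 𝓘(D)ⁿ)` of `𝓘_S = ker τ` (the tree's `blowup.ker_pushforwardMap`
is the case of a regular hypersurface `S`, where the union stops at `n = 1`).
[cite: Kollar2007, 3.30.2] [cite: GortzWedhorn2020, Prop. 13.96 (2)] -/
theorem blowup.ker_pushforwardMap_eq_strictTransformIdeal {S X : Scheme.{u}} [IsLocallyNoetherian X]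
    (C' : S.IdealSheafData) (τ : S ⟶ X) [IsClosedImmersion τ] :
    (blowup.pushforwardMap C' τ).ker =
      strictTransformIdeal (blowup.π (C'.map τ)) (C'.map τ) τ.ker :=
  ker_eq_strictTransformIdeal_of_comp_eq (blowup.isBlowup (C'.map τ)) τ
    (blowup.isBlowup_comap_map C' τ) (blowup.pushforwardMap_π C' τ)

end Summit.ResolutionOfSingularities.ResolutionOfSingularities.Theorems.SigmaMaxModificationsCorridor3.Helpers

end
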